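import Summits.HodgeConjecture.CorCM.IrreducibleOddWeightsIsotypicSplitting
import Summits.HodgeConjecture.CorCM.IrreducibleOddWeightsIsotypicDensity
import HarnessLib

/-!
# The multiplicity formula across all isotypic classes, I: ONE SLOT — `S(Σ_c p_c) = ⨆_c S(p_c)` for parts in
# independent stable subspaces, and THE CLASS PARTS OF ONE SLOT ARE INDEPENDENT

COR-CM (cell `pub-hodgecm2`, binder seat `b16` gen 75, count-neutral claim THE MULTIPLICITY FORMULA ACROSS ALL
ISOTYPIC CLASSES FOR A WHOLE FAMILY, file M1 — abstract `G`-set level; theorems only, no definition, no named fact,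
no `sorry`).  NEW as stated, hence under `Summits/`.  HONEST FRAMING: linear algebra of translates of functions on
finite `G`-sets (gen 70 files I1–I4 `…IsotypicCells`, `…IsotypicCellsIso`, `…IsotypicContainers`,
`…IsotypicSplitting`); nothing about Hodge classes is asserted, `HC_CM` is neither used nor asserted.  Gen 74's
files S3–S6 count a whole family of slots inside ONE isotypic class; gen 70 I11 / gen 73 K6 / gen 74 S7 split a
PAIR of slots over all classes.  This file and its sequels (M2 `…MultiClassBlocks`, M3 `…MultiClassRank`) do both at
once: a whole family, all classes.

SETTING.  `G` acts on a finite pivot `Y₀` (one slot); `S(w) = span{g ↦ w(g·y) : y ∈ Y₀} ≤ ℚ^G`.  REFERENCE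
IRREDUCIBLES: labels `c ∈ C`, for each a finite pivot `Y_c` and ONE stable irreducible `A_c ≤ ℚ^{Y_c}`, the `A_c`
PAIRWISE NON-ISOMORPHIC — no linear map embeds a non-zero `A_c` equivariantly into `A_{c′}`, `c ≠ c′` (hypothesis
`hsep`).  The class-`c` part of the slot is assembled from `A_c` by equivariant embeddings `ι_{c,j} : A_c → ℚ^{Y₀}`
(`j ∈ J_c`) jointly independent on `A_c`: `p_c = Σ_j ι_{c,j}(b_{c,j})`, `b_{c,j} ∈ A_c`.

* §1 **THE SUM FORMULA** (`span_shadowCoeff_finset_sum_eq_sup_of_iSupIndep`, `span_shadowCoeff_sum_eq_iSup_of_iSupIndep`):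
  `P_c ≤ ℚ^{Y₀}` stable and INDEPENDENT, `p_c ∈ P_c` ⟹ **`S(Σ_c p_c) = ⨆_c S(p_c)`** (gen 70 I4's binary sum formula
  iterated: the equivariant projection onto `P_c` carries `Σ p` to `p_c`).
* §2 TRANSPORT (`exists_embed_of_map_embed`): an equivariant embedding `θ(A) ↪ θ′(B)` of IMAGES under equivariant maps
  injective on `A`, `B` gives an equivariant embedding `A ↪ B` of the references (`θ′⁻¹ ∘ L ∘ θ`; gen 70 I3's
  `exists_map_of_cell_iso` is the case of two cells).
* §3 **THE CLASS PARTS OF ONE SLOT ARE INDEPENDENT** (`iSupIndep_iSup_map_of_classes`): the subspaces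
  `P_c = Σ_j ι_{c,j}(A_c) ≤ ℚ^{Y₀}` form an INDEPENDENT family (gen 70 I2's cross-type independence: an irreducible in
  the meet would make some `ι_{c,j}(A_c)` isomorphic to some `ι_{c′,j′}(A_{c′})`, hence `A_c ↪ A_{c′}` by §2); so the
  embeddings of ALL classes are jointly independent (`jointly_independent_sigma_of_classes`) and
  **`S(Σ_c Σ_j ι_{c,j}(b_{c,j})) = ⨆_c S(Σ_j ι_{c,j}(b_{c,j}))`** (`span_shadowCoeff_sum_classes_eq_iSup`).

## References

* [Serre1977] J.-P. Serre, *Linear Representations of Finite Groups*, GTM 42, §1.4 (complements), §2.2 (Schur),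
  §2.6 (canonical decomposition).
* [Lang2002] S. Lang, *Algebra*, 3rd ed., XVII §1 Prop. 1.1, XVII §2 (semisimple modules).
* [Gordon1999HodgeAVSurvey] B. B. Gordon, *A survey of the Hodge conjecture for abelian varieties*, §3 Theorem (proof),
  7.5–7.7.
-/

set_option autoImplicit false

noncomputable section

open scoped BigOperators Classical

universe u uC uJ v v' vA vB vC vZ vZ' w

namespace Summit.HodgeConjecture.CorCM.IrrOdd

open Literature.NumberTheory.ComplexMultiplication

variable {G : Type w} [Group G] {Y₀ : Type v'} [MulAction G Y₀] [Fintype Y₀]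

/-! ### §1 The sum formula over an independent family of stable parts -/

/-- **THE SUM FORMULA (finite-set form).**  `P_c ≤ ℚ^{Y₀}` stable and INDEPENDENT, `p_c ∈ P_c` ⟹
`S(Σ_{c∈s} p_c) = sup_{c∈s} S(p_c)` — induction on `s`: the equivariant projection onto `P_a` along `Σ_{c∈s} P_c`
carries the sum to `p_a` (file I4's binary sum formula). [cite: Serre1977, §1.4 and §2.6]
[cite: Gordon1999HodgeAVSurvey, §3 Theorem (proof)] -/
theorem span_shadowCoeff_finset_sum_eq_sup_of_iSupIndep {C : Type uC} {P : C → Submodule ℚ (Y₀ → ℚ)}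
    (hPst : ∀ (c : C) (k : G) (a : Y₀ → ℚ), a ∈ P c → (fun y => a (k • y)) ∈ P c) (hP : iSupIndep P)
    {p : C → (Y₀ → ℚ)} (hp : ∀ c, p c ∈ P c) (s : Finset C) :
    Submodule.span ℚ (Set.range fun y : Y₀ => fun g : G => (∑ c ∈ s, p c) (g • y)) =
      s.sup fun c => Submodule.span ℚ (Set.range fun y : Y₀ => fun g : G => p c (g • y)) := by
  refine Finset.induction_on s ?_ ?_
  · rw [Finset.sum_empty, Finset.sup_empty, (span_shadowCoeff_eq_bot_iff (G := G) (0 : Y₀ → ℚ)).2 rfl]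
  intro a s ha ih
  rw [Finset.sum_insert ha, Finset.sup_insert, ← ih]
  -- `Q = Σ_{c∈s} P_c` is stable and meets `P_a` trivially
  let T : G → (Y₀ → ℚ) →ₗ[ℚ] (Y₀ → ℚ) := fun k => LinearMap.funLeft ℚ ℚ (fun y : Y₀ => k • y)
  have hQst : ∀ (k : G) (f : Y₀ → ℚ), f ∈ s.sup P → (fun y => f (k • y)) ∈ s.sup P :=
    fun k f hf => stable_finset_sup T P (fun c k f hf => hPst c k f hf) s k f hf
  have hPQ : P a ⊓ s.sup P = ⊥ := by
    rw [← disjoint_iff, Finset.sup_eq_iSup]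
    exact hP.disjoint_biSup (y := (↑s : Set C)) fun h => ha (Finset.mem_coe.1 h)
  have hq : (∑ c ∈ s, p c) ∈ s.sup P :=
    Submodule.sum_mem _ fun c hc => (Finset.le_sup hc : P c ≤ s.sup P) (hp c)
  exact span_shadowCoeff_add_eq_sup_of_inf_eq_bot (hPst a) hQst hPQ (hp a) hq

/-- **THE SUM FORMULA: `S(Σ_c p_c) = ⨆_c S(p_c)`** for parts `p_c` in stable INDEPENDENT subspaces `P_c ≤ ℚ^{Y₀}`
over a finite label set. [cite: Serre1977, §1.4 and §2.6] [cite: Gordon1999HodgeAVSurvey, §3 Theorem (proof)] -/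
theorem span_shadowCoeff_sum_eq_iSup_of_iSupIndep {C : Type uC} [Fintype C] {P : C → Submodule ℚ (Y₀ → ℚ)}
    (hPst : ∀ (c : C) (k : G) (a : Y₀ → ℚ), a ∈ P c → (fun y => a (k • y)) ∈ P c) (hP : iSupIndep P)
    {p : C → (Y₀ → ℚ)} (hp : ∀ c, p c ∈ P c) :
    Submodule.span ℚ (Set.range fun y : Y₀ => fun g : G => (∑ c, p c) (g • y)) =
      ⨆ c, Submodule.span ℚ (Set.range fun y : Y₀ => fun g : G => p c (g • y)) := by
  rw [← Finset.sup_univ_eq_iSup]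
  exact span_shadowCoeff_finset_sum_eq_sup_of_iSupIndep hPst hP hp Finset.univ

/-! ### §2 Transport: an embedding of images gives an embedding of references -/

section Transport

variable {YA : Type vA} [MulAction G YA] {YB : Type vB} [MulAction G YB]
  {Z : Type vZ} [MulAction G Z] {Z' : Type vZ'} [MulAction G Z']

/-- **AN EMBEDDING OF IMAGES GIVES AN EMBEDDING OF REFERENCES.**  `A ≤ ℚ^{Y_A}`, `B ≤ ℚ^{Y_B}` stable; `θ : ℚ^{Y_A} →
ℚ^{Z}`, `θ′ : ℚ^{Y_B} → ℚ^{Z′}` linear, equivariant and injective on `A` resp. `B`; `L : ℚ^{Z} → ℚ^{Z′}` linear, mapping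
`θ(A)` into `θ′(B)`, injective and equivariant on `θ(A)`.  Then some linear `L′ : ℚ^{Y_A} → ℚ^{Y_B}` maps `A` into `B`,
is injective on `A` and EQUIVARIANT on `A` (`L′ = θ′⁻¹ ∘ L ∘ θ` on `A`, extended anyhow). [cite: Serre1977, §2.2]
[cite: Lang2002, XVII §1 Prop. 1.1] -/
theorem exists_embed_of_map_embed {A : Submodule ℚ (YA → ℚ)} {B : Submodule ℚ (YB → ℚ)}
    (hAst : ∀ (k : G) (a : YA → ℚ), a ∈ A → (fun y => a (k • y)) ∈ A)
    (hBst : ∀ (k : G) (b : YB → ℚ), b ∈ B → (fun y => b (k • y)) ∈ B)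
    (θ : (YA → ℚ) →ₗ[ℚ] (Z → ℚ)) (θ' : (YB → ℚ) →ₗ[ℚ] (Z' → ℚ))
    (hθeq : ∀ (k : G) (a : YA → ℚ), a ∈ A → θ (fun y => a (k • y)) = fun z => θ a (k • z))
    (hθ'eq : ∀ (k : G) (b : YB → ℚ), b ∈ B → θ' (fun y => b (k • y)) = fun z => θ' b (k • z))
    (hθinj : ∀ a ∈ A, θ a = 0 → a = 0) (hθ'inj : ∀ b ∈ B, θ' b = 0 → b = 0)
    (L : (Z → ℚ) →ₗ[ℚ] (Z' → ℚ)) (hL : ∀ v ∈ A.map θ, L v ∈ B.map θ')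
    (hLinj : ∀ v ∈ A.map θ, L v = 0 → v = 0)
    (hLeq : ∀ (k : G) (v : Z → ℚ), v ∈ A.map θ → L (fun z => v (k • z)) = fun z => L v (k • z)) :
    ∃ L' : (YA → ℚ) →ₗ[ℚ] (YB → ℚ), (∀ a ∈ A, L' a ∈ B) ∧ (∀ a ∈ A, L' a = 0 → a = 0) ∧
      ∀ (k : G) (a : YA → ℚ), a ∈ A → L' (fun y => a (k • y)) = fun y => L' a (k • y) := by
  -- invert `θ'|_B` on its range, which contains `L(θ(A))`
  have hinj' : Function.Injective (θ'.domRestrict B) := by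
    intro a b hab
    apply Subtype.ext
    have hsub : θ' ((a : YB → ℚ) - b) = 0 := by
      rw [map_sub, sub_eq_zero]
      exact hab
    exact sub_eq_zero.1 (hθ'inj _ (B.sub_mem a.2 b.2) hsub)
  have hmem : ∀ a : A, (L ∘ₗ θ).domRestrict A a ∈ LinearMap.range (θ'.domRestrict B) := fun a => by
    rw [LinearMap.range_domRestrict]
    exact hL _ ⟨a, a.2, rfl⟩
  obtain ⟨L', hL'⟩ := LinearMap.exists_extend
    (B.subtype ∘ₗ (LinearEquiv.ofInjective (θ'.domRestrict B) hinj').symm.toLinearMap ∘ₗ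
      LinearMap.codRestrict (LinearMap.range (θ'.domRestrict B)) ((L ∘ₗ θ).domRestrict A) hmem)
  -- on `A`: `L' a ∈ B` and `θ' (L' a) = L (θ a)`
  have hLa : ∀ a ∈ A, L' a ∈ B ∧ θ' (L' a) = L (θ a) := by
    intro a ha
    have h1 := LinearMap.congr_fun hL' ⟨a, ha⟩
    simp only [LinearMap.coe_comp, Function.comp_apply, Submodule.coe_subtype, LinearEquiv.coe_coe] at h1
    refine ⟨by rw [h1]; exact Submodule.coe_mem _, ?_⟩
    have h2 := LinearEquiv.ofInjective_symm_apply (θ'.domRestrict B) (h := hinj')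
      (LinearMap.codRestrict (LinearMap.range (θ'.domRestrict B)) ((L ∘ₗ θ).domRestrict A) hmem ⟨a, ha⟩)
    rw [LinearMap.domRestrict_apply] at h2
    rw [h1, h2]
    rfl
  refine ⟨L', fun a ha => (hLa a ha).1, fun a ha h0 => ?_, fun k a ha => ?_⟩
  · have h := (hLa a ha).2
    rw [h0, map_zero] at h
    exact hθinj a ha (hLinj _ ⟨a, ha, rfl⟩ h.symm)
  · -- both sides lie in `B` and have the same image under `θ'`
    have hak : (fun y => a (k • y)) ∈ A := hAst k a ha
    have hdiff := hθ'inj (L' (fun y => a (k • y)) - fun y => L' a (k • y))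
      (B.sub_mem (hLa _ hak).1 (hBst k _ (hLa a ha).1)) (by
        rw [map_sub, (hLa _ hak).2, hθeq k a ha, hLeq k _ ⟨a, ha, rfl⟩, ← (hLa a ha).2,
          ← hθ'eq k _ (hLa a ha).1, sub_self])
    exact sub_eq_zero.1 hdiff

end Transport

/-! ### §3 The class parts of one slot are independent -/

section OneSlot

variable {C : Type uC} {Yc : C → Type vC} [∀ c, MulAction G (Yc c)] [∀ c, Fintype (Yc c)]
  {Ar : ∀ c, Submodule ℚ (Yc c → ℚ)} {JJ : C → Type uJ} [∀ c, Fintype (JJ c)]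

omit [Fintype Y₀] [∀ c, Fintype (Yc c)] [∀ c, MulAction G (Yc c)] [MulAction G Y₀] [Group G] in
/-- A member of a jointly independent family of embeddings is injective on `A` (test the family on the tuple
supported at one index). [folklore] -/
theorem eq_zero_of_jointly_independent {c : C} (ι : JJ c → ((Yc c → ℚ) →ₗ[ℚ] (Y₀ → ℚ)))
    (hind : ∀ f : JJ c → (Yc c → ℚ), (∀ j, f j ∈ Ar c) → ∑ j, ι j (f j) = 0 → ∀ j, f j = 0)
    (j : JJ c) (a : Yc c → ℚ) (ha : a ∈ Ar c) (h0 : ι j a = 0) : a = 0 := by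
  have hf : ∀ j', (Pi.single j a : JJ c → (Yc c → ℚ)) j' ∈ Ar c := fun j' => by
    by_cases hj : j' = j
    · subst hj
      rw [Pi.single_eq_same]
      exact ha
    · rw [Pi.single_eq_of_ne hj]
      exact Submodule.zero_mem _
  have hsum : ∑ j', ι j' ((Pi.single j a : JJ c → (Yc c → ℚ)) j') = 0 := by
    rw [Finset.sum_eq_single j (fun j' _ hj' => by rw [Pi.single_eq_of_ne hj', map_zero])
      (fun h => absurd (Finset.mem_univ j) h), Pi.single_eq_same, h0]
  have h := hind (Pi.single j a) hf hsum j
  rwa [Pi.single_eq_same] at h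

omit [Fintype Y₀] in
/-- **THE CLASS PARTS OF ONE SLOT ARE INDEPENDENT.**  Reference irreducibles `A_c ≤ ℚ^{Y_c}` (stable, irreducible,
pairwise non-isomorphic: `hsep`), equivariant embeddings `ι_{c,j} : A_c → ℚ^{Y₀}` jointly independent on `A_c` for
each `c`.  Then the subspaces **`P_c = Σ_j ι_{c,j}(A_c) ≤ ℚ^{Y₀}` are INDEPENDENT**: each image `ι_{c,j}(A_c)` is a
stable irreducible (file I8 `map_irreducible_of_intertwine`), no image of class `c` embeds into an image of class
`c′ ≠ c` (§2 + `hsep`), so file I2's cross-type independence applies to `P_c` against `Σ_{c′ ≠ c} P_{c′}`.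
[cite: Serre1977, §2.6] [cite: Lang2002, XVII §2] -/
theorem iSupIndep_iSup_map_of_classes [Fintype C]
    (hRst : ∀ c (k : G) (a : Yc c → ℚ), a ∈ Ar c → (fun y => a (k • y)) ∈ Ar c)
    (hRirr : ∀ c (W : Submodule ℚ (Yc c → ℚ)), W ≤ Ar c → W ≠ ⊥ →
      (∀ (k : G) (f : Yc c → ℚ), f ∈ W → (fun y => f (k • y)) ∈ W) → W = Ar c)
    (hsep : ∀ c c' (L : (Yc c → ℚ) →ₗ[ℚ] (Yc c' → ℚ)), c ≠ c' → Ar c ≠ ⊥ → (∀ a ∈ Ar c, L a ∈ Ar c') →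
      (∀ a ∈ Ar c, L a = 0 → a = 0) →
      (∀ (k : G) (a : Yc c → ℚ), a ∈ Ar c → L (fun y => a (k • y)) = fun y => L a (k • y)) → False)
    (ι : ∀ c, JJ c → ((Yc c → ℚ) →ₗ[ℚ] (Y₀ → ℚ)))
    (hιeq : ∀ c (j : JJ c) (k : G) (a : Yc c → ℚ), a ∈ Ar c →
      ι c j (fun y => a (k • y)) = fun y => ι c j a (k • y))
    (hind : ∀ c (f : JJ c → (Yc c → ℚ)), (∀ j, f j ∈ Ar c) → ∑ j, ι c j (f j) = 0 → ∀ j, f j = 0) :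
    iSupIndep fun c => ⨆ j, (Ar c).map (ι c j) := by
  let T : G → (Y₀ → ℚ) →ₗ[ℚ] (Y₀ → ℚ) := fun k => LinearMap.funLeft ℚ ℚ (fun y : Y₀ => k • y)
  -- every image is stable and irreducible for the translates
  have himg : ∀ c (j : JJ c),
      (∀ (k : G) (v : Y₀ → ℚ), v ∈ (Ar c).map (ι c j) → T k v ∈ (Ar c).map (ι c j)) ∧
        ∀ W : Submodule ℚ (Y₀ → ℚ), W ≤ (Ar c).map (ι c j) → W ≠ ⊥ →
          (∀ (k : G) (v : Y₀ → ℚ), v ∈ W → T k v ∈ W) → W = (Ar c).map (ι c j) := fun c j =>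
    map_irreducible_of_intertwine (fun k => LinearMap.funLeft ℚ ℚ (fun y : Yc c => k • y)) T (ι c j)
      (fun k a ha => hRst c k a ha) (fun W hW hW0 hWst => hRirr c W hW hW0 fun k f hf => hWst k f hf)
      (fun k a ha => hιeq c j k a ha)
  intro c
  rw [disjoint_iff]
  -- regroup the other classes as one family over a `Σ`-type
  have hle : (⨆ (c' : C) (_ : c' ≠ c), ⨆ j, (Ar c').map (ι c' j)) ≤
      ⨆ q : (Σ c' : {c' // c' ≠ c}, JJ c'.1), (Ar q.1.1).map (ι q.1.1 q.2) := by
    refine iSup₂_le fun c' hc' => iSup_le fun j => ?_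
    exact le_iSup (fun q : (Σ c' : {c' // c' ≠ c}, JJ c'.1) => (Ar q.1.1).map (ι q.1.1 q.2)) ⟨⟨c', hc'⟩, j⟩
  refine eq_bot_iff.2 (le_trans (inf_le_inf_left _ hle) (le_of_eq ?_))
  refine iSup_inf_iSup_eq_bot_of_forall_not_embed (A := fun j => (Ar c).map (ι c j))
    (B := fun q : (Σ c' : {c' // c' ≠ c}, JJ c'.1) => (Ar q.1.1).map (ι q.1.1 q.2))
    (fun j k v hv => (himg c j).1 k v hv) (fun j W hW hW0 hWst => (himg c j).2 W hW hW0 hWst)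
    (fun q k v hv => (himg q.1.1 q.2).1 k v hv) (fun q W hW hW0 hWst => (himg q.1.1 q.2).2 W hW hW0 hWst) ?_
  intro j q L hne hL hLinj hLeq
  obtain ⟨L', hL'B, hL'inj, hL'eq⟩ := exists_embed_of_map_embed (hRst c) (hRst q.1.1) (ι c j) (ι q.1.1 q.2)
    (hιeq c j) (hιeq q.1.1 q.2) (eq_zero_of_jointly_independent (ι c) (hind c) j)
    (eq_zero_of_jointly_independent (ι q.1.1) (hind q.1.1) q.2) L hL hLinj hLeq
  refine hsep c q.1.1 L' (fun h => q.1.2 h.symm) (fun h => hne ?_) hL'B hL'inj hL'eq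
  rw [h, Submodule.map_bot]

omit [Fintype Y₀] in
/-- **THE EMBEDDINGS OF ALL CLASSES ARE JOINTLY INDEPENDENT**: if `Σ_{c,j} ι_{c,j}(f_{c,j}) = 0` with `f_{c,j} ∈ A_c`,
then every `f_{c,j} = 0` (the class sums vanish by independence of the `P_c`, then each class by its own joint
independence). [cite: Serre1977, §2.6] [cite: Lang2002, XVII §2] -/
theorem jointly_independent_sigma_of_classes [Fintype C]
    (hRst : ∀ c (k : G) (a : Yc c → ℚ), a ∈ Ar c → (fun y => a (k • y)) ∈ Ar c)
    (hRirr : ∀ c (W : Submodule ℚ (Yc c → ℚ)), W ≤ Ar c → W ≠ ⊥ →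
      (∀ (k : G) (f : Yc c → ℚ), f ∈ W → (fun y => f (k • y)) ∈ W) → W = Ar c)
    (hsep : ∀ c c' (L : (Yc c → ℚ) →ₗ[ℚ] (Yc c' → ℚ)), c ≠ c' → Ar c ≠ ⊥ → (∀ a ∈ Ar c, L a ∈ Ar c') →
      (∀ a ∈ Ar c, L a = 0 → a = 0) →
      (∀ (k : G) (a : Yc c → ℚ), a ∈ Ar c → L (fun y => a (k • y)) = fun y => L a (k • y)) → False)
    (ι : ∀ c, JJ c → ((Yc c → ℚ) →ₗ[ℚ] (Y₀ → ℚ)))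
    (hιeq : ∀ c (j : JJ c) (k : G) (a : Yc c → ℚ), a ∈ Ar c →
      ι c j (fun y => a (k • y)) = fun y => ι c j a (k • y))
    (hind : ∀ c (f : JJ c → (Yc c → ℚ)), (∀ j, f j ∈ Ar c) → ∑ j, ι c j (f j) = 0 → ∀ j, f j = 0)
    (f : ∀ p : (Σ c, JJ c), Yc p.1 → ℚ) (hf : ∀ p, f p ∈ Ar p.1)
    (h0 : ∑ p : Σ c, JJ c, ι p.1 p.2 (f p) = 0) (p : Σ c, JJ c) : f p = 0 := by
  have hP := iSupIndep_iSup_map_of_classes hRst hRirr hsep ι hιeq hind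
  -- the class sums
  have hvmem : ∀ c, (∑ j, ι c j (f ⟨c, j⟩)) ∈ ⨆ j, (Ar c).map (ι c j) := fun c =>
    Submodule.sum_mem _ fun j _ => Submodule.mem_iSup_of_mem j ⟨f ⟨c, j⟩, hf ⟨c, j⟩, rfl⟩
  have hsum : ∑ c, ∑ j, ι c j (f ⟨c, j⟩) = 0 := by
    rw [← h0, Fintype.sum_sigma]
  have hvc : ∀ c, ∑ j, ι c j (f ⟨c, j⟩) = 0 := by
    intro c
    have hrest : ∑ j, ι c j (f ⟨c, j⟩) = -∑ c' ∈ Finset.univ.erase c, ∑ j, ι c' j (f ⟨c', j⟩) := by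
      rw [eq_neg_iff_add_eq_zero,
        Finset.add_sum_erase Finset.univ (fun c' => ∑ j, ι c' j (f ⟨c', j⟩)) (Finset.mem_univ c)]
      exact hsum
    have hmem : (∑ j, ι c j (f ⟨c, j⟩)) ∈ ⨆ (c' : C) (_ : c' ≠ c), ⨆ j, (Ar c').map (ι c' j) := by
      rw [hrest]
      refine Submodule.neg_mem _ (Submodule.sum_mem _ fun c' hc' => ?_)
      have hne : c' ≠ c := (Finset.mem_erase.1 hc').1
      exact Submodule.mem_iSup_of_mem c' (Submodule.mem_iSup_of_mem hne (hvmem c'))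
    exact (Submodule.disjoint_def.1 (hP c)) _ (hvmem c) hmem
  obtain ⟨c, j⟩ := p
  exact hind c (fun j => f ⟨c, j⟩) (fun j => hf ⟨c, j⟩) (hvc c) j

/-- **ONE SLOT SPLITS OVER THE CLASSES: `S(Σ_c Σ_j ι_{c,j}(b_{c,j})) = ⨆_c S(Σ_j ι_{c,j}(b_{c,j}))`** — the
shadow-coefficient space of a vector assembled from pairwise non-isomorphic reference irreducibles is the sum of the
shadow-coefficient spaces of its class parts (§1 on the independent stable parts `P_c = Σ_j ι_{c,j}(A_c)` of §3).
[cite: Serre1977, §2.6] [cite: Gordon1999HodgeAVSurvey, §3 Theorem (proof), 7.5–7.7] -/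
theorem span_shadowCoeff_sum_classes_eq_iSup [Fintype C]
    (hRst : ∀ c (k : G) (a : Yc c → ℚ), a ∈ Ar c → (fun y => a (k • y)) ∈ Ar c)
    (hRirr : ∀ c (W : Submodule ℚ (Yc c → ℚ)), W ≤ Ar c → W ≠ ⊥ →
      (∀ (k : G) (f : Yc c → ℚ), f ∈ W → (fun y => f (k • y)) ∈ W) → W = Ar c)
    (hsep : ∀ c c' (L : (Yc c → ℚ) →ₗ[ℚ] (Yc c' → ℚ)), c ≠ c' → Ar c ≠ ⊥ → (∀ a ∈ Ar c, L a ∈ Ar c') →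
      (∀ a ∈ Ar c, L a = 0 → a = 0) →
      (∀ (k : G) (a : Yc c → ℚ), a ∈ Ar c → L (fun y => a (k • y)) = fun y => L a (k • y)) → False)
    (ι : ∀ c, JJ c → ((Yc c → ℚ) →ₗ[ℚ] (Y₀ → ℚ)))
    (hιeq : ∀ c (j : JJ c) (k : G) (a : Yc c → ℚ), a ∈ Ar c →
      ι c j (fun y => a (k • y)) = fun y => ι c j a (k • y))
    (hind : ∀ c (f : JJ c → (Yc c → ℚ)), (∀ j, f j ∈ Ar c) → ∑ j, ι c j (f j) = 0 → ∀ j, f j = 0)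
    {b : ∀ c, JJ c → (Yc c → ℚ)} (hb : ∀ c j, b c j ∈ Ar c) :
    Submodule.span ℚ (Set.range fun y : Y₀ => fun g : G => (∑ c, ∑ j, ι c j (b c j)) (g • y)) =
      ⨆ c, Submodule.span ℚ (Set.range fun y : Y₀ => fun g : G => (∑ j, ι c j (b c j)) (g • y)) := by
  let T : G → (Y₀ → ℚ) →ₗ[ℚ] (Y₀ → ℚ) := fun k => LinearMap.funLeft ℚ ℚ (fun y : Y₀ => k • y)
  have hst : ∀ c (k : G) (v : Y₀ → ℚ), v ∈ (⨆ j, (Ar c).map (ι c j)) →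
      (fun y => v (k • y)) ∈ ⨆ j, (Ar c).map (ι c j) := fun c =>
    stable_iSup T (fun j => (Ar c).map (ι c j)) fun j k v hv => by
      obtain ⟨a, ha, rfl⟩ := hv
      exact ⟨fun y => a (k • y), hRst c k a ha, hιeq c j k a ha⟩
  exact span_shadowCoeff_sum_eq_iSup_of_iSupIndep hst (iSupIndep_iSup_map_of_classes hRst hRirr hsep ι hιeq hind)
    fun c => Submodule.sum_mem _ fun j _ => Submodule.mem_iSup_of_mem j ⟨b c j, hb c j, rfl⟩

end OneSlot

end Summit.HodgeConjecture.CorCM.IrrOdd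

end
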